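import Summits.RiemannHypothesis.RiemannHypothesis.Theses.NymanBeurling
import Literature.NumberTheory.LFunctions.RHClassicalEquivalentsProofs

/-!
# RiemannHypothesis / NymanBeurling — calibration of the thesis `NbThesis`

Route `RiemannHypothesis/NymanBeurling` (RH as the Báez-Duarte `L²` approximation problem on the
critical line). Its rank-0 target `NbThesis` (item stmt-RiemannHypothesis-0392) reads: for every
`ε > 0` some Dirichlet polynomial `A(s) = Σ_{k<N} a_k (k+1)^{-s}` has
`∫⁻ |1 - ζ(1/2+it) A(1/2+it)|² dt/(1/4+t²) < ε`.

This file records, kernel-checked, where the thesis and the route's cruxes sit: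

* `nbThesis_iff_riemannHypothesis` — `NbThesis ↔ RiemannHypothesis` (Mathlib's statement), from
  the two halves of Báez-Duarte's Theorem 1.1 proved in the tree
  (`Literature.NumberTheory.LFunctions.riemannHypothesis_of_dirichlet_approx`, elementary half, and
  `Literature.NumberTheory.LFunctions.baezDuarte_dirichlet_onlyIf_holds`, deep half); hence
  `nbThesis_iff` (`NbThesis ↔ Summit.RiemannHypothesis`): the target is exactly summit-strength.
* `nbThesis_of_nbRateLog` — crux #2 (`NbRateLog`, a bound `C/log N` for every `N ≥ 2`) implies the
  thesis (`C/log N → 0`), hence RH (`riemannHypothesis_of_nbRateLog`).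
* `nbThesis_of_nbMoebiusMollifier` — crux #3 (`NbMoebiusMollifier`, the thesis with the explicit
  smoothed Möbius weights) implies the thesis (take those weights), hence RH
  (`riemannHypothesis_of_nbMoebiusMollifier`).
* `nbConverse_holds'` / `assembly_holds'` — the support item `NbConverse` (RH → thesis) and the
  assembly (thesis → RH) are the two directions of `nbThesis_iff`, stated here under primed names
  as corollaries (their items are closed by their own provers).

References: L. Báez-Duarte, Rend. Lincei (9) 14 (2003) 5–11, Thm. 1.1; S. Bettin, J. B. Conrey,
D. W. Farmer, Proc. Steklov Inst. 280 (2013), §1 (the `d_N` form).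
-/

noncomputable section

open Filter Topology MeasureTheory
open scoped Real ENNReal

namespace Summit.RiemannHypothesis.RiemannHypothesis.Theorems

open Summit.RiemannHypothesis.RiemannHypothesis.Theses.NymanBeurling

/-- **Calibration of the target.** The Nyman–Beurling–Báez-Duarte thesis `NbThesis` is equivalent
to Mathlib's `RiemannHypothesis`: the elementary half (approximation ⇒ RH) is
`Literature.NumberTheory.LFunctions.riemannHypothesis_of_dirichlet_approx`, the deep half
(RH ⇒ approximation) is `Literature.NumberTheory.LFunctions.baezDuarte_dirichlet_onlyIf_holds`.
[BaezDuarte2003, Thm. 1.1] -/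
theorem nbThesis_iff_riemannHypothesis : NbThesis ↔ _root_.RiemannHypothesis := by
  unfold NbThesis
  exact ⟨Literature.NumberTheory.LFunctions.riemannHypothesis_of_dirichlet_approx,
    Literature.NumberTheory.LFunctions.baezDuarte_dirichlet_onlyIf_holds⟩

/-- The target `NbThesis` is exactly summit-strength: `NbThesis ↔ Summit.RiemannHypothesis`
(`Summit.RiemannHypothesis` unfolds to Mathlib's `RiemannHypothesis`). [BaezDuarte2003, Thm. 1.1] -/
theorem nbThesis_iff : NbThesis ↔ Summit.RiemannHypothesis :=
  nbThesis_iff_riemannHypothesis.trans Summit.RiemannHypothesis_iff.symm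

/-- Deep half as an implication (the content of the support item `NbConverse`,
stmt-RiemannHypothesis-0396): under RH the Báez-Duarte distances tend to `0`.
[BaezDuarte2003, Thm. 1.1 (only-if part)] -/
theorem nbConverse_holds' : Summit.RiemannHypothesis → NbThesis :=
  nbThesis_iff.mpr

/-- Elementary half as an implication (the content of the assembly item,
stmt-RiemannHypothesis-0393): if the Báez-Duarte distances tend to `0` then RH holds.
[BaezDuarte2003, Thm. 1.1 (if part); Beurling1955] -/
theorem assembly_holds' : NbThesis → Summit.RiemannHypothesis :=
  nbThesis_iff.mp

/-- **Crux #2 implies the thesis.** If one constant `C` bounds the distance integral of some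
length-`N` Dirichlet polynomial by `C / log N` for every `N ≥ 2` (`NbRateLog`,
stmt-RiemannHypothesis-0394), then the distances tend to `0` (`NbThesis`): `C / log N → 0`.
[folklore] -/
theorem nbThesis_of_nbRateLog : NbRateLog → NbThesis := by
  unfold NbRateLog NbThesis
  rintro ⟨C, hC⟩ ε hε
  -- `C / log N → 0` along `N → ∞` in `ℕ`
  have hlog : Tendsto (fun N : ℕ ↦ Real.log (N : ℝ)) atTop atTop :=
    Real.tendsto_log_atTop.comp tendsto_natCast_atTop_atTop
  have hlim : Tendsto (fun N : ℕ ↦ C / Real.log (N : ℝ)) atTop (𝓝 0) :=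
    tendsto_const_nhds.div_atTop hlog
  obtain ⟨N, hN2, hNε⟩ := ((eventually_ge_atTop 2).and (hlim.eventually (gt_mem_nhds hε))).exists
  obtain ⟨a, ha⟩ := hC N hN2
  exact ⟨N, a, ha.trans_lt ((ENNReal.ofReal_lt_ofReal_iff hε).mpr hNε)⟩

/-- **Crux #3 implies the thesis.** If the explicit smoothed Möbius polynomials
`A_N(s) = Σ_{k≤N} μ(k)(1 - log k/log N) k^{-s}` achieve arbitrarily small distance integrals
(`NbMoebiusMollifier`, stmt-RiemannHypothesis-0395), then `NbThesis` holds (take these weights as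
the coefficients). [folklore] -/
theorem nbThesis_of_nbMoebiusMollifier : NbMoebiusMollifier → NbThesis := by
  unfold NbMoebiusMollifier NbThesis
  intro h ε hε
  obtain ⟨N, hN⟩ := h ε hε
  exact ⟨N, _, hN⟩

/-- Crux #2 is at least summit-strength: `NbRateLog → Summit.RiemannHypothesis`
(through `NbThesis`). [folklore] -/
theorem riemannHypothesis_of_nbRateLog : NbRateLog → Summit.RiemannHypothesis :=
  fun h ↦ nbThesis_iff.mp (nbThesis_of_nbRateLog h)

/-- Crux #3 is at least summit-strength: `NbMoebiusMollifier → Summit.RiemannHypothesis`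
(through `NbThesis`). [folklore] -/
theorem riemannHypothesis_of_nbMoebiusMollifier : NbMoebiusMollifier → Summit.RiemannHypothesis :=
  fun h ↦ nbThesis_iff.mp (nbThesis_of_nbMoebiusMollifier h)

end Summit.RiemannHypothesis.RiemannHypothesis.Theorems

end
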